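import Summits.HubbardSuperconductivity.HubbardSuperconductivity.Theorems.DeformationLadderLowEnergyRigidityTelescopeDefs
import Summits.HubbardSuperconductivity.HubbardSuperconductivity.Theorems.DeformationLadderLadderThesisRigidityReduction

/-!
# Route `DeformationLadder`, crux `LowEnergyRigidity` (item `stmt-HubbardSuperconductivity-1892`):
# the Poincaré telescope — ground-energy normal forms of the two inputs

Support file (`--supports stmt-HubbardSuperconductivity-1892`) for the crux idea `poincare-telescope`
(ideator 3, round 1). The telescope (`…TelescopeReduction`) closes `LowEnergyRigidity` from
`JosephsonInequalityAt` and `CoherenceFloorAt` (`…TelescopeDefs`), both of which quantify over all unit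
vectors of the sector. Suppliers (stiffness technologies for the first, thermodynamic-limit + convexity
for the second) output statements about sector GROUND ENERGIES; this file records the two translations,
by the variational principle alone (`minEnergyOn_le_re_rayleigh`, `le_csInf`):

* `josephsonInequalityAt_iff_groundEnergy` — the Josephson family IS the family of lower bounds
  `minEnergyOn (H_L − J(k/L)⁴·𝒟_k) ≥ minEnergyOn H_L − C J k³/L` on the sector (the energy cost of
  REWARDING cell-phase gradients at rate `J(k/L)⁴` is at most the slack): `4 ≤ k`, `k ℓ₀ ≤ L`,
  eventually in even `L`;
* `coherenceFloorAt_of_penaltyGap`, `penaltyGap_of_coherenceFloorAt` — the floor is EQUIVALENT (up to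
  the bookkeeping `ε ↔ ε/2`, `c = τε/2`, `τ = c/(|r₀|+1)`) to an EXTENSIVE COHERENCE-PENALTY GAP
  `minEnergyOn (H_L + τ·(k²/L²)·𝒞_k) ≥ minEnergyOn H_L + τ (r₀ − ε) L²` for some `τ = τ(ε) > 0` on the
  bottom window — a statement about two energy densities only (`(k²/L²)𝒞_k` is an extensive sum of local
  positive terms), i.e. by concavity of `τ ↦ minEnergyOn (H_L + τ X)` the strict positivity
  `r₀ ≤ ∂⁺_τ e(τ)|₀` of a one-sided derivative of an energy density, as the card says.

Also: `exists_unit_mem_szSector` (the crux's sector contains a unit vector, from the route's landed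
`penalisedGroundStateExists_proof`) and `le_minEnergyOn_of_forall_unit`.
All [folklore] (Tasaki 2020 §2.1 variational principle); source of the statements: the idea card.
-/

noncomputable section

namespace Summit.HubbardSuperconductivity.HubbardSuperconductivity.Theorems.LowEnergyRigidity.Telescope

set_option linter.dupNamespace false -- summit = problem name (single-conjunct summit), D-0017

open Matrix
open scoped ComplexOrder
open Literature.MathematicalPhysics.QuantumLattice Literature.Probability.LatticeModels
open Summit.HubbardSuperconductivity.HubbardSuperconductivity.Theses.DeformationLadder
open Summit.HubbardSuperconductivity.HubbardSuperconductivity.Theorems.DeformationLadder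
  (penalisedGroundStateExists_proof)

/-! ### Variational bookkeeping -/

section Variational

variable {n : Type*} [Fintype n]

/-- Lower bounds pass to the sector energy: if `K` contains a unit vector and `b ≤ Re⟨ψ, A ψ⟩` for
every unit `ψ ∈ K`, then `b ≤ minEnergyOn A K`. Tasaki (2020) §2.1. [folklore] -/
theorem le_minEnergyOn_of_forall_unit (A : Matrix n n ℂ) (K : Submodule ℂ (n → ℂ)) {b : ℝ}
    (hne : ∃ ψ ∈ K, star ψ ⬝ᵥ ψ = 1)
    (h : ∀ ψ ∈ K, star ψ ⬝ᵥ ψ = 1 → b ≤ (star ψ ⬝ᵥ A *ᵥ ψ).re) : b ≤ A.minEnergyOn K := by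
  obtain ⟨ψ₀, hψ₀K, hψ₀⟩ := hne
  refine le_csInf ⟨_, ψ₀, hψ₀K, hψ₀, rfl⟩ ?_
  rintro E ⟨ψ, hψK, hψ, rfl⟩
  exact h ψ hψK hψ

/-- Quadratic form of `A + (s : ℂ) • B` (real parts). [folklore] -/
theorem re_rayleigh_add_smul (A B : Matrix n n ℂ) (s : ℝ) (ψ : n → ℂ) :
    (star ψ ⬝ᵥ (A + (s : ℂ) • B) *ᵥ ψ).re = (star ψ ⬝ᵥ A *ᵥ ψ).re + s * (star ψ ⬝ᵥ B *ᵥ ψ).re := by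
  rw [add_mulVec, dotProduct_add, Complex.add_re, smul_mulVec, dotProduct_smul, smul_eq_mul,
    Complex.re_ofReal_mul]

/-- Quadratic form of `A - (s : ℂ) • B` (real parts). [folklore] -/
theorem re_rayleigh_sub_smul (A B : Matrix n n ℂ) (s : ℝ) (ψ : n → ℂ) :
    (star ψ ⬝ᵥ (A - (s : ℂ) • B) *ᵥ ψ).re = (star ψ ⬝ᵥ A *ᵥ ψ).re - s * (star ψ ⬝ᵥ B *ᵥ ψ).re := by
  rw [sub_mulVec, dotProduct_sub, Complex.sub_re, smul_mulVec, dotProduct_smul, smul_eq_mul,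
    Complex.re_ofReal_mul]

end Variational

/-- The crux's sector `szSector (2⌊(1-δ)L²/2⌋) 0` contains a unit vector whenever `0 ≤ δ`
(`⌊(1-δ)L²/2⌋ ≤ L²` electrons of each spin fit on the torus; a normalised sector ground state of
`H_L + 0·Δ_dᴴΔ_d` from the route's `penalisedGroundStateExists_proof` will do). [folklore] -/
theorem exists_unit_mem_szSector (L : ℕ) [NeZero L] (U : ℝ) {δ : ℝ} (hδ : 0 ≤ δ) :
    ∃ ψ ∈ szSector (Λ := FermionTorus 2 L) (2 * ⌊(1 - δ) * (L : ℝ) ^ 2 / 2⌋₊) 0, star ψ ⬝ᵥ ψ = 1 := by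
  have hn : ⌊(1 - δ) * (L : ℝ) ^ 2 / 2⌋₊ ≤ L ^ 2 := by
    have h1 : ((⌊(1 - δ) * (L : ℝ) ^ 2 / 2⌋₊ : ℕ) : ℝ) ≤ ((L ^ 2 : ℕ) : ℝ) := by
      rcases le_or_gt 0 ((1 - δ) * (L : ℝ) ^ 2 / 2) with h0 | h0
      · refine (Nat.floor_le h0).trans ?_
        push_cast
        nlinarith [sq_nonneg (L : ℝ)]
      · rw [Nat.floor_of_nonpos h0.le]
        exact_mod_cast Nat.zero_le _
    exact_mod_cast h1
  obtain ⟨φ, hφ1, hφ⟩ := penalisedGroundStateExists_proof L U 0 _ hn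
  exact ⟨φ, hφ.1, hφ1⟩

/-! ### The Josephson family in ground-energy form -/

/-- **Josephson inequalities ⟺ ground-energy lower bounds.** For `0 ≤ δ`,
`JosephsonInequalityAt U δ J C ℓ₀` holds iff, eventually in even `L`, for all `4 ≤ k`, `k ℓ₀ ≤ L`,
`minEnergyOn H_L K − C J k³/L ≤ minEnergyOn (H_L − J(k/L)⁴·𝒟_k) K` (`K` the crux's sector): rewarding
cell-phase gradients at rate `J(k/L)⁴` lowers the sector ground energy by at most the slack.
(`→`: `le_csInf` over unit sector vectors; `←`: the variational principle at `φ`.) [folklore] -/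
theorem josephsonInequalityAt_iff_groundEnergy {U δ J C : ℝ} {ℓ₀ : ℕ} (hδ : 0 ≤ δ) :
    JosephsonInequalityAt U δ J C ℓ₀ ↔
      ∃ L₀ : ℕ, ∀ (L : ℕ) [NeZero L], L₀ ≤ L → Even L → ∀ (k : ℕ) [NeZero k], 4 ≤ k → k * ℓ₀ ≤ L →
        (hubbardTorus 2 L 1 U).minEnergyOn
            (szSector (Λ := FermionTorus 2 L) (2 * ⌊(1 - δ) * (L : ℝ) ^ 2 / 2⌋₊) 0) -
          C * J * (k : ℝ) ^ 3 / (L : ℝ) ≤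
        (hubbardTorus 2 L 1 U - ((J * ((k : ℝ) / (L : ℝ)) ^ 4 : ℝ) : ℂ) • cellDirichlet L k).minEnergyOn
            (szSector (Λ := FermionTorus 2 L) (2 * ⌊(1 - δ) * (L : ℝ) ^ 2 / 2⌋₊) 0) := by
  constructor
  · rintro ⟨L₀, h⟩
    refine ⟨L₀, fun L _ hL hev k _ hk hkl => ?_⟩
    refine le_minEnergyOn_of_forall_unit _ _ (exists_unit_mem_szSector L U hδ) fun ψ hψK hψ1 => ?_
    have h1 := h L hL hev k hk hkl ψ hψK hψ1
    rw [re_rayleigh_sub_smul]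
    unfold expect at h1
    linarith
  · rintro ⟨L₀, h⟩
    refine ⟨L₀, fun L _ hL hev k _ hk hkl φ hφK hφ1 => ?_⟩
    have h1 := h L hL hev k hk hkl
    have h2 := minEnergyOn_le_re_rayleigh
      (hubbardTorus 2 L 1 U - ((J * ((k : ℝ) / (L : ℝ)) ^ 4 : ℝ) : ℂ) • cellDirichlet L k) _ hφK hφ1
    rw [re_rayleigh_sub_smul] at h2
    unfold expect
    linarith

/-! ### The coherence floor in penalty-gap form -/

/-- **Extensive coherence-penalty gap ⇒ coherence floor.** Suppose that for every `ε > 0` some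
`τ > 0` makes, eventually in even `L` and for every cell count of the bottom window
`k ℓ₀ ≤ L < 2kℓ₀`, `minEnergyOn H_L K + τ (r₀ − ε) L² ≤ minEnergyOn (H_L + τ·(k²/L²)·𝒞_k) K`. Then
`CoherenceFloorAt U δ r₀ ℓ₀` (with allowance `c = τ(ε/2)·ε/2` for the floor `r₀ − ε`): for a unit
`φ ∈ K` with `Re⟨H⟩ ≤ E₀ + cL²`, the variational principle for the penalised matrix at `φ` gives
`E₀ + τ(r₀ − ε/2)L² ≤ Re⟨H⟩ + τ(k²/L²)Re⟨𝒞_k⟩ ≤ E₀ + cL² + τ L² · (k²/L⁴)Re⟨𝒞_k⟩`. [folklore] -/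
theorem coherenceFloorAt_of_penaltyGap {U δ r₀ : ℝ} {ℓ₀ : ℕ}
    (h : ∀ ε : ℝ, 0 < ε → ∃ τ : ℝ, 0 < τ ∧ ∃ L₀ : ℕ, ∀ (L : ℕ) [NeZero L], L₀ ≤ L → Even L →
      ∀ (k : ℕ) [NeZero k], k * ℓ₀ ≤ L → L < 2 * k * ℓ₀ →
        (hubbardTorus 2 L 1 U).minEnergyOn
            (szSector (Λ := FermionTorus 2 L) (2 * ⌊(1 - δ) * (L : ℝ) ^ 2 / 2⌋₊) 0) +
          τ * (r₀ - ε) * (L : ℝ) ^ 2 ≤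
        (hubbardTorus 2 L 1 U + ((τ * (k : ℝ) ^ 2 / (L : ℝ) ^ 2 : ℝ) : ℂ) • cellCoherence L k).minEnergyOn
            (szSector (Λ := FermionTorus 2 L) (2 * ⌊(1 - δ) * (L : ℝ) ^ 2 / 2⌋₊) 0)) :
    CoherenceFloorAt U δ r₀ ℓ₀ := by
  intro ε hε
  obtain ⟨τ, hτ, L₀, h⟩ := h (ε / 2) (by positivity)
  refine ⟨τ * (ε / 2), by positivity, max L₀ 1, fun L _ hL hev k _ hk1 hk2 φ hφK hφ1 hE => ?_⟩
  have hL0 : L₀ ≤ L := le_trans (le_max_left _ _) hL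
  have hL1 : 1 ≤ L := le_trans (le_max_right _ _) hL
  have hLr : (0 : ℝ) < (L : ℝ) := by exact_mod_cast hL1
  have h1 := h L hL0 hev k hk1 hk2
  have h2 := minEnergyOn_le_re_rayleigh
    (hubbardTorus 2 L 1 U + ((τ * (k : ℝ) ^ 2 / (L : ℝ) ^ 2 : ℝ) : ℂ) • cellCoherence L k) _ hφK hφ1
  rw [re_rayleigh_add_smul] at h2
  -- `τ L² ((k²/L⁴) C) = (τ k²/L²) C`
  set Cc := (expect (cellCoherence L k) φ).re with hCc
  have e : τ * (k : ℝ) ^ 2 / (L : ℝ) ^ 2 * Cc = τ * (L : ℝ) ^ 2 * ((k : ℝ) ^ 2 / (L : ℝ) ^ 4 * Cc) := by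
    field_simp
  unfold expect at hCc
  rw [← hCc, e] at h2
  -- `τ L² · (r₀ - ε) ≤ τ L² · density`
  have hτL : 0 < τ * (L : ℝ) ^ 2 := by positivity
  have key : τ * (L : ℝ) ^ 2 * (r₀ - ε) ≤ τ * (L : ℝ) ^ 2 * ((k : ℝ) ^ 2 / (L : ℝ) ^ 4 * Cc) := by
    nlinarith
  exact le_of_mul_le_mul_left key hτL

/-- **Coherence floor ⇒ extensive coherence-penalty gap** (converse bookkeeping, `τ = c/(|r₀|+1)`):
from `CoherenceFloorAt U δ r₀ ℓ₀` (and `0 ≤ δ`, for the sector to be non-empty), for every `ε > 0` some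
`τ > 0` makes `minEnergyOn H_L K + τ(r₀ − ε)L² ≤ minEnergyOn (H_L + τ·(k²/L²)·𝒞_k) K` eventually on the
bottom window: a unit `ψ ∈ K` either has `Re⟨H⟩ > E₀ + cL² ≥ E₀ + τ(r₀ − ε)L²` (and `𝒞_k ⪰ 0`), or the
floor applies and `τ(k²/L²)Re⟨𝒞_k⟩ ≥ τ(r₀ − ε)L²`. [folklore] -/
theorem penaltyGap_of_coherenceFloorAt {U δ r₀ : ℝ} {ℓ₀ : ℕ} (hδ : 0 ≤ δ)
    (hF : CoherenceFloorAt U δ r₀ ℓ₀) :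
    ∀ ε : ℝ, 0 < ε → ∃ τ : ℝ, 0 < τ ∧ ∃ L₀ : ℕ, ∀ (L : ℕ) [NeZero L], L₀ ≤ L → Even L →
      ∀ (k : ℕ) [NeZero k], k * ℓ₀ ≤ L → L < 2 * k * ℓ₀ →
        (hubbardTorus 2 L 1 U).minEnergyOn
            (szSector (Λ := FermionTorus 2 L) (2 * ⌊(1 - δ) * (L : ℝ) ^ 2 / 2⌋₊) 0) +
          τ * (r₀ - ε) * (L : ℝ) ^ 2 ≤
        (hubbardTorus 2 L 1 U + ((τ * (k : ℝ) ^ 2 / (L : ℝ) ^ 2 : ℝ) : ℂ) • cellCoherence L k).minEnergyOn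
            (szSector (Λ := FermionTorus 2 L) (2 * ⌊(1 - δ) * (L : ℝ) ^ 2 / 2⌋₊) 0) := by
  intro ε hε
  obtain ⟨c, hc, L₀, h⟩ := hF ε hε
  have hr : 0 < |r₀| + 1 := by positivity
  refine ⟨c / (|r₀| + 1), by positivity, max L₀ 1, fun L _ hL hev k _ hk1 hk2 => ?_⟩
  have hL0 : L₀ ≤ L := le_trans (le_max_left _ _) hL
  have hL1 : 1 ≤ L := le_trans (le_max_right _ _) hL
  have hLr : (0 : ℝ) < (L : ℝ) := by exact_mod_cast hL1
  set τ : ℝ := c / (|r₀| + 1) with hτ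
  have hτpos : 0 < τ := by positivity
  -- `τ (r₀ - ε) ≤ c`
  have hτc : τ * (r₀ - ε) ≤ c := by
    have h1 : τ * (r₀ - ε) ≤ τ * |r₀| := by
      have : r₀ - ε ≤ |r₀| := by linarith [le_abs_self r₀]
      exact mul_le_mul_of_nonneg_left this hτpos.le
    have h2 : τ * |r₀| ≤ τ * (|r₀| + 1) := by nlinarith
    have h3 : τ * (|r₀| + 1) = c := by rw [hτ]; field_simp
    linarith
  refine le_minEnergyOn_of_forall_unit _ _ (exists_unit_mem_szSector L U hδ) fun ψ hψK hψ1 => ?_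
  rw [re_rayleigh_add_smul]
  set E₀ := (hubbardTorus 2 L 1 U).minEnergyOn
    (szSector (Λ := FermionTorus 2 L) (2 * ⌊(1 - δ) * (L : ℝ) ^ 2 / 2⌋₊) 0) with hE₀
  set Cc := (star ψ ⬝ᵥ cellCoherence L k *ᵥ ψ).re with hCc
  have hCnonneg : 0 ≤ Cc := by
    have hpsd : (cellCoherence L k).PosSemidef :=
      posSemidef_sum _ fun b _ => posSemidef_conjTranspose_mul_self (cellPair L k b)
    have := hpsd.re_dotProduct_nonneg ψ
    rw [RCLike.re_to_complex] at this
    rw [hCc]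
    exact this
  have hvar : E₀ ≤ (star ψ ⬝ᵥ hubbardTorus 2 L 1 U *ᵥ ψ).re := minEnergyOn_le_re_rayleigh _ _ hψK hψ1
  have e : τ * (k : ℝ) ^ 2 / (L : ℝ) ^ 2 * Cc = τ * (L : ℝ) ^ 2 * ((k : ℝ) ^ 2 / (L : ℝ) ^ 4 * Cc) := by
    field_simp
  rw [e]
  have hL2 : 0 < (L : ℝ) ^ 2 := by positivity
  by_cases hcase : (star ψ ⬝ᵥ hubbardTorus 2 L 1 U *ᵥ ψ).re ≤ E₀ + c * (L : ℝ) ^ 2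
  · -- the floor applies
    have hfl := h L hL0 hev k hk1 hk2 ψ hψK hψ1 hcase
    unfold expect at hfl
    rw [← hCc] at hfl
    have : τ * (L : ℝ) ^ 2 * (r₀ - ε) ≤ τ * (L : ℝ) ^ 2 * ((k : ℝ) ^ 2 / (L : ℝ) ^ 4 * Cc) :=
      mul_le_mul_of_nonneg_left hfl (by positivity)
    nlinarith
  · -- high energy: the penalty is non-negative and `c L² ≥ τ (r₀ - ε) L²`
    rw [not_le] at hcase
    have h1 : τ * (r₀ - ε) * (L : ℝ) ^ 2 ≤ c * (L : ℝ) ^ 2 := mul_le_mul_of_nonneg_right hτc hL2.le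
    have h2 : 0 ≤ τ * (L : ℝ) ^ 2 * ((k : ℝ) ^ 2 / (L : ℝ) ^ 4 * Cc) := by positivity
    linarith

end Summit.HubbardSuperconductivity.HubbardSuperconductivity.Theorems.LowEnergyRigidity.Telescope
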